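import Literature.Analysis.FluidPDE.KatoWeightedDuhamel
import Literature.Analysis.FluidPDE.KochTataruPairing
import Literature.Analysis.FluidPDE.MildL3Restart
import HarnessLib

/-!
# Kato fixed points at unit viscosity are continuous in `L³`: the time-translation argument

Analysis/FluidPDE support file, a further layer of the unit-viscosity discharge of Kato's weighted
local existence theorem in `L³(ℝ³)` (`kato_local_L3_unit`, `KatoLocalL3Scaling.lean`; Kato 1984,
Thm. 1; Lemarié-Rieusset 2016, Thm. 7.5: "`u ∈ C([0,T₀], (L³)³)` … we must check that `B(u,u)`
belongs to `C([0,T],(L³)³)`", PDF p. 157). For a pointwise fixed point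
`u(t) = e^{tΔ}u₀ - B(u,u)(t)` on `(0, T)` (`B = kochTataruBilinear`, unit viscosity, dimension
three) in Kato's weighted class — `t^{1/4}‖u(t)‖₆ ≤ a` with `a` small, `√t |u(t,x)| ≤ b`, and the
*vanishing* `sup_{s<t} s^{1/4}‖u(s)‖₆ → 0` as `t → 0` — this file proves `u ∈ C([0,T); L³)`
(`KatoL3.exists_continuousInLpOn_of_fixedPoint`).

Instead of the printed estimate through `W_{ν(t-s)} - W_{ν(θ-s)} = ∫ νΔW` (loc. cit.), which
needs time derivatives of the Oseen kernel, the proof uses the **time-translation covariance** of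
the Duhamel operator (`KatoL3.kochTataruBilinear_add_time`):
`B(u,u)(s+h) = B(u·1_{(0,h)}, u)(s+h) + B(u(·+h), u(·+h))(s)`, whence, with `w = u(·+h) - u`,
`u(s+h) - u(s) = e^{sΔ}(e^{hΔ}u₀ - u₀) - B(u·1_{(0,h)}, u)(s+h) - B(w, u(·+h))(s) - B(u, w)(s)`.
Kato's estimates (`KatoWeightedDuhamel.lean`) bound the last three terms in `L³` by `K ε(h)²` and
`2Kaω(h)`, where `ε(h) = sup_{σ<h} σ^{1/4}‖u(σ)‖₆ → 0` and `ω(h) = sup_σ σ^{1/4}‖w(σ)‖₆`; the same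
decomposition in the weighted `L⁶` norm gives `ω(h) ≤ C‖e^{hΔ}u₀ - u₀‖₃ + Kε(h)² + 2Kaω(h)`,
so `ω(h) → 0` once `4Ka ≤ 1`, and `‖u(s+h) - u(s)‖₃ → 0` uniformly in `s`
(`KatoL3.exists_modulus_of_fixedPoint`). Continuity at `t = 0` is
`‖u(t) - u₀‖₃ ≤ ‖e^{tΔ}u₀ - u₀‖₃ + Kε(t)²`.

Everything is proved; no definitions (grouping namespace `KatoL3`).

## Mathlib / tree search

Tree: `KatoL3.exists_eLpNorm_kochTataruBilinear_le`, `KatoL3.exists_norm_kochTataruBilinear_le`,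
`KatoL3.eLpNorm_norm_mul_norm_three_le`, `…_six_le_of_right/left` (`KatoWeightedDuhamel.lean`);
`kochTataruBilinear_self_sub_self` (`KochTataruFixedPoint.lean`);
`stronglyMeasurable_kochTataruBilinear_slice` (`KochTataruPairing.lean`); the heat semigroup on
`Lᵖ`: `heatExtension_add_holds`, `eLpNorm_heatExtension_le_holds`, `eLpNorm_heatExtension_le_rpow_holds`,
`tendsto_heatExtension_nhdsWithin_zero_holds`, `heatExtension_sub_eq_of_memLp` (`HeatKernel*.lean`,
`MildL3Restart.lean`). Nothing on `C_t L³` continuity of Oseen–Duhamel terms existed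
(`lean search 'ContinuousInLpOn.*kochTataru|kochTataru.*ContinuousInLpOn'`). Mathlib:
`MeasurePreserving.setIntegral_preimage_emb`, `setIntegral_union`, `ENNReal.tendsto_nhds_zero`.

## References

* T. Kato, Math. Z. 187 (1984) 471–480, Thm. 1, §2. [Kato1984]
* P. G. Lemarié-Rieusset, *The Navier–Stokes Problem in the 21st Century*, CRC Press 2016,
  doi:10.1201/b19556, Thm. 7.5 and its proof, PDF p. 157 (continuity of `B(u,u)` in `L³`). [LemarieRieusset2016]
-/

noncomputable section

open MeasureTheory TopologicalSpace Set Function Filter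
open _root_.Topology
open scoped ENNReal NNReal RealInnerProductSpace

namespace Literature.Analysis.FluidPDE

namespace KatoL3

variable {E : Type*} [NormedAddCommGroup E] [InnerProductSpace ℝ E] [FiniteDimensional ℝ E]
  [MeasurableSpace E] [BorelSpace E]

/-! ### Time translation of the Duhamel operator -/

/-- **Time-translation covariance of the bilinear Duhamel operator.** For `s, h > 0` and a point
`x` where the space–time integrand of `B(u,v)(s+h)(x)` is absolutely integrable,
`B(u,v)(s+h)(x) = B(u·1_{(0,h)}, v)(s+h)(x) + B(u(·+h), v(·+h))(s)(x)`: split the time integral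
at `h` (`K[0, ·] = 0` realises the cut-off) and translate the second part by `h`. [folklore] -/
theorem kochTataruBilinear_add_time {u v : ℝ → E → E} {s h : ℝ} (hs : 0 < s) (hh : 0 < h) {x : E}
    (hint : Integrable (fun p : ℝ × E => oseenKernel (s + h - p.1) (x - p.2) (u p.1 p.2) (v p.1 p.2))
      ((volume : Measure (ℝ × E)).restrict (Ioo 0 (s + h) ×ˢ univ))) :
    kochTataruBilinear u v (s + h) x =
      kochTataruBilinear (fun τ => if τ < h then u τ else 0) v (s + h) x +
        kochTataruBilinear (fun τ => u (τ + h)) (fun τ => v (τ + h)) s x := by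
  set F : ℝ → E := fun σ => ∫ y, oseenKernel (s + h - σ) (x - y) (u σ y) (v σ y) with hF
  have hFint : IntegrableOn F (Ioo 0 (s + h)) volume := by
    have h1 := hint
    rw [volume_restrict_prod_univ_eq_prod] at h1
    exact h1.integral_prod_left
  have hsh : 0 < s + h := by linarith
  -- split the time integral at `h`
  have hsplit : kochTataruBilinear u v (s + h) x = (∫ σ in Ioo 0 h, F σ) + ∫ σ in Ico h (s + h), F σ := by
    unfold kochTataruBilinear
    rw [← Ioo_union_Ico_eq_Ioo hh (by linarith : h ≤ s + h)]
    exact setIntegral_union (Set.disjoint_left.2 fun σ h1 h2 => (not_lt.2 h2.1) h1.2)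
      measurableSet_Ico (hFint.mono_set (Ioo_subset_Ioo le_rfl (by linarith)))
      (hFint.mono_set (Ico_subset_Ioo_left hh))
  -- the cut-off field realises the first part
  have hcut : kochTataruBilinear (fun τ => if τ < h then u τ else 0) v (s + h) x = ∫ σ in Ioo 0 h, F σ := by
    unfold kochTataruBilinear
    have heq : (fun σ => ∫ y, oseenKernel (s + h - σ) (x - y)
        ((fun τ => if τ < h then u τ else 0) σ y) (v σ y)) = (Iio h).indicator F := by
      funext σ
      by_cases hσ : σ < h
      · rw [indicator_of_mem (mem_Iio.2 hσ)]
        simp only [hσ, if_true]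
        rfl
      · rw [indicator_of_notMem (fun h' => hσ (mem_Iio.1 h'))]
        simp only [hσ, if_false, Pi.zero_apply, oseenKernel_zero_left, integral_zero]
    have hset : Ioo 0 (s + h) ∩ Iio h = Ioo 0 h := by
      ext σ
      constructor
      · rintro ⟨h1, h2⟩; exact ⟨h1.1, h2⟩
      · rintro ⟨h1, h2⟩; exact ⟨⟨h1, lt_of_lt_of_le h2 (by linarith)⟩, h2⟩
    rw [heq, setIntegral_indicator measurableSet_Iio, hset]
  -- the translated fields realise the second part
  have hshift : kochTataruBilinear (fun τ => u (τ + h)) (fun τ => v (τ + h)) s x =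
      ∫ σ in Ico h (s + h), F σ := by
    unfold kochTataruBilinear
    have hmp : MeasurePreserving (fun τ : ℝ => τ + h) volume volume := measurePreserving_add_right volume h
    have hemb : MeasurableEmbedding (fun τ : ℝ => τ + h) := measurableEmbedding_addRight h
    have hpre : (fun τ : ℝ => τ + h) ⁻¹' Ico h (s + h) = Ico 0 s := by
      ext τ
      simp only [mem_preimage, mem_Ico]
      constructor
      · rintro ⟨h1, h2⟩; exact ⟨by linarith, by linarith⟩
      · rintro ⟨h1, h2⟩; exact ⟨by linarith, by linarith⟩
    have hcomp := hmp.setIntegral_preimage_emb hemb F (Ico h (s + h))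
    rw [hpre, integral_Ico_eq_integral_Ioo] at hcomp
    rw [← hcomp]
    refine setIntegral_congr_fun measurableSet_Ioo fun τ _ => ?_
    have hτ : s + h - (τ + h) = s - τ := by ring
    simp only [hF, hτ]
  rw [hsplit, hcut, hshift]

/-! ### Measurability of cut-off and translated fields -/

omit [InnerProductSpace ℝ E] [FiniteDimensional ℝ E] [BorelSpace E] in
/-- The time translate `(τ, x) ↦ u(τ + h, x)` of a jointly strongly measurable field is jointly
strongly measurable. [folklore] -/
theorem stronglyMeasurable_uncurry_shift [NormedSpace ℝ E] {u : ℝ → E → E}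
    (hu : StronglyMeasurable (uncurry u)) (h : ℝ) :
    StronglyMeasurable (uncurry fun τ => u (τ + h)) :=
  hu.comp_measurable ((measurable_fst.add_const h).prodMk measurable_snd)

omit [InnerProductSpace ℝ E] [FiniteDimensional ℝ E] [BorelSpace E] in
/-- The time cut-off `(τ, x) ↦ 1_{τ<h} u(τ, x)` of a jointly strongly measurable field is jointly
strongly measurable. [folklore] -/
theorem stronglyMeasurable_uncurry_cut [NormedSpace ℝ E] {u : ℝ → E → E}
    (hu : StronglyMeasurable (uncurry u)) (h : ℝ) :
    StronglyMeasurable (uncurry fun τ => if τ < h then u τ else 0) := by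
  have heq : uncurry (fun τ => if τ < h then u τ else (0 : E → E)) =
      (Iio h ×ˢ (univ : Set E)).indicator (uncurry u) := by
    funext p
    rcases p with ⟨τ, y⟩
    by_cases hτ : τ < h <;> simp [hτ]
  rw [heq]
  exact hu.indicator (measurableSet_Iio.prod MeasurableSet.univ)

/-! ### The uniform modulus of continuity -/

set_option maxHeartbeats 1600000 in
-- (a single long estimate; the default budget does not suffice)
/-- **Uniform `L³` modulus of continuity of Kato fixed points** (Lemarié-Rieusset 2016, proof of
Thm. 7.5, PDF p. 157: `B(u,u) ∈ C([0,T],(L³)³)`). In dimension three there is `ε₀ = ε₀(E) > 0`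
such that: if `u` is jointly strongly measurable, satisfies
`u(t) = e^{tΔ}u₀ - B(u,u)(t)` pointwise for `t ∈ (0, T)` with `u₀ ∈ L³`, the bounds
`‖u(t)‖₆ ≤ a t^{-1/4}` with `a ≤ ε₀`, `|u(t,x)| ≤ b t^{-1/2}`, and the vanishing
`∀ ε, ∃ δ, ∀ t < δ, ‖u(t)‖₆ ≤ ε t^{-1/4}`, then for every `ε > 0` there is `h₀ > 0` with
`‖u(s+h) - u(s)‖_{L³} ≤ ε` for all `0 < h < h₀` and all `s > 0` with `s + h < T`. Proof in the
module docstring (time-translation covariance, Kato's estimates, absorption of the weighted `L⁶`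
modulus `ω(h)` for `4Kε₀ ≤ 1`). [cite: LemarieRieusset2016, Thm. 7.5 (proof, PDF p. 157)] -/
theorem exists_modulus_of_fixedPoint (hE : Module.finrank ℝ E = 3) :
    ∃ ε₀ : ℝ, 0 < ε₀ ∧ ∀ {u₀ : E → E} {u : ℝ → E → E} {T a b : ℝ},
      MemLp u₀ 3 volume → StronglyMeasurable (uncurry u) → 0 ≤ a → a ≤ ε₀ → 0 ≤ b →
      (∀ t ∈ Ioo 0 T, ∀ x, u t x =
        UnboundedOperators.heatExtension u₀ t x - kochTataruBilinear u u t x) →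
      (∀ t ∈ Ioo 0 T, eLpNorm (u t) 6 volume ≤ ENNReal.ofReal (a * t ^ (-(1 / 4 : ℝ)))) →
      (∀ t ∈ Ioo 0 T, ∀ x, ‖u t x‖ ≤ b * t ^ (-(1 / 2 : ℝ))) →
      (∀ ε > 0, ∃ δ > 0, ∀ t ∈ Ioo 0 δ, t < T →
        eLpNorm (u t) 6 volume ≤ ENNReal.ofReal (ε * t ^ (-(1 / 4 : ℝ)))) →
      ∀ ε > 0, ∃ h₀ > 0, ∀ h ∈ Ioo 0 h₀, ∀ s, 0 < s → s + h < T →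
        eLpNorm (u (s + h) - u s) 3 volume ≤ ENNReal.ofReal ε := by
  -- the constants: Kato's bounds `K`, the pointwise bound `K'`, the `L³ → L⁶` smoothing `C₆`
  obtain ⟨K, hK0, hK⟩ := exists_eLpNorm_kochTataruBilinear_le hE
  obtain ⟨K', hK'0, hK'⟩ := exists_norm_kochTataruBilinear_le hE
  obtain ⟨C₆, hC₆⟩ := UnboundedOperators.eLpNorm_heatExtension_le_rpow_holds E E
    (p := 3) (q := 6) (by norm_num) (by norm_num)
  have hexp6 : ∀ r : ℝ, 0 < r →
      r ^ (-((Module.finrank ℝ E : ℝ) / 2) * ((1 / (3 : ℝ≥0∞)).toReal - (1 / (6 : ℝ≥0∞)).toReal)) =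
        r ^ (-(1 / 4 : ℝ)) := by
    intro r _
    congr 1
    rw [show (Module.finrank ℝ E : ℝ) = 3 by exact_mod_cast hE]
    norm_num [ENNReal.toReal_div]
  have hC₆' : ∀ {g : E → E}, MemLp g 3 volume → ∀ {r : ℝ}, 0 < r →
      eLpNorm (UnboundedOperators.heatExtension g r) 6 volume ≤
        (C₆ : ℝ≥0∞) * ENNReal.ofReal (r ^ (-(1 / 4 : ℝ))) * eLpNorm g 3 volume := by
    intro g hg r hr
    have h := hC₆ g hg r hr
    rwa [hexp6 r hr] at h
  refine ⟨1 / (4 * (K + 1)), by positivity,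
    fun {u₀ u T a b} hu₀ hsm ha haε hb hfix h6 hinf hvan ε hε => ?_⟩
  have h31 : (1 : ℝ≥0∞) ≤ 3 := by norm_num
  have hKa : 2 * K * a ≤ 1 / 2 := by
    have h1 : K * a ≤ K * (1 / (4 * (K + 1))) := mul_le_mul_of_nonneg_left haε hK0.le
    have h2 : K * (1 / (4 * (K + 1))) ≤ 1 / 4 := by
      rw [mul_one_div, div_le_iff₀ (by positivity)]; nlinarith
    linarith
  -- sizes: `η` for the heat semigroup, `ε'` for the small-time weighted norm
  set η : ℝ := ε / (4 * ((C₆ : ℝ) + 1)) with hη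
  have hη0 : 0 < η := by positivity
  set ε' : ℝ := min 1 (ε / (8 * (K + 1))) with hε'
  have hε'0 : 0 < ε' := lt_min one_pos (by positivity)
  have hε'1 : ε' ≤ 1 := min_le_left _ _
  have hε'sq : K * ε' ^ 2 ≤ ε / 8 := by
    have h1 : ε' ^ 2 ≤ ε' := by nlinarith
    have h2 : ε' ≤ ε / (8 * (K + 1)) := min_le_right _ _
    calc K * ε' ^ 2 ≤ K * (ε / (8 * (K + 1))) := by nlinarith
      _ ≤ ε / 8 := by rw [mul_comm, div_mul_eq_mul_div, div_le_div_iff₀ (by positivity) (by positivity)]; nlinarith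
  -- strong continuity of the heat semigroup at `0` in `L³`
  have hheat : ∃ h₁ > 0, ∀ h ∈ Ioo 0 h₁,
      eLpNorm (UnboundedOperators.heatExtension u₀ h - u₀) 3 volume ≤ ENNReal.ofReal η := by
    have ht := UnboundedOperators.tendsto_heatExtension_nhdsWithin_zero_holds hu₀ h31 (by norm_num)
    have hev := (ENNReal.tendsto_nhds_zero.1 ht) (ENNReal.ofReal η) (by simpa using hη0)
    obtain ⟨h₁, hh₁, hsub⟩ := mem_nhdsGT_iff_exists_Ioo_subset.1 hev
    exact ⟨h₁, hh₁, fun h hh => hsub hh⟩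
  obtain ⟨h₁, hh₁, hheat⟩ := hheat
  obtain ⟨δ, hδ, hvan'⟩ := hvan ε' hε'0
  refine ⟨min h₁ δ, lt_min hh₁ hδ, fun h hh s hs hsT => ?_⟩
  have hh0 : 0 < h := hh.1
  have hhh₁ : h < h₁ := hh.2.trans_le (min_le_left _ _)
  have hhδ : h < δ := hh.2.trans_le (min_le_right _ _)
  have hT : 0 < T := by linarith
  -- ### the fields `uh = u(· + h)`, `w = uh - u`, `uc = u · 1_{(0,h)}`
  set uh : ℝ → E → E := fun τ => u (τ + h) with huh_def
  set w : ℝ → E → E := uh - u with hw_def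
  set uc : ℝ → E → E := fun τ => if τ < h then u τ else 0 with huc_def
  have hsm_uh : StronglyMeasurable (uncurry uh) := stronglyMeasurable_uncurry_shift hsm h
  have hsm_w : StronglyMeasurable (uncurry w) := by
    have : uncurry w = uncurry uh - uncurry u := by
      funext p; rcases p with ⟨τ, y⟩; simp [hw_def]
    rw [this]; exact hsm_uh.sub hsm
  have hsm_uc : StronglyMeasurable (uncurry uc) := stronglyMeasurable_uncurry_cut hsm h
  have hslice : ∀ {f : ℝ → E → E}, StronglyMeasurable (uncurry f) → ∀ τ, AEStronglyMeasurable (f τ) volume :=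
    fun hf τ => (hf.comp_measurable (measurable_const.prodMk measurable_id)).aestronglyMeasurable
  have hIoi : ∀ {f : ℝ → E → E}, StronglyMeasurable (uncurry f) →
      AEStronglyMeasurable (uncurry f) ((volume : Measure (ℝ × E)).restrict (Ioi 0 ×ˢ univ)) :=
    fun hf => hf.aestronglyMeasurable
  -- weighted `L⁶` bounds
  have h6_uh : ∀ τ ∈ Ioo 0 (T - h), eLpNorm (uh τ) 6 volume ≤ ENNReal.ofReal (a * τ ^ (-(1 / 4 : ℝ))) := by
    intro τ hτ
    refine (h6 (τ + h) ⟨by linarith [hτ.1], by linarith [hτ.2]⟩).trans (ENNReal.ofReal_le_ofReal ?_)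
    exact mul_le_mul_of_nonneg_left (Real.rpow_le_rpow_of_nonpos hτ.1 (by linarith) (by norm_num)) ha
  have h6_uc : ∀ τ, 0 < τ → eLpNorm (uc τ) 6 volume ≤ ENNReal.ofReal (ε' * τ ^ (-(1 / 4 : ℝ))) := by
    intro τ hτ
    by_cases hτh : τ < h
    · simp only [huc_def, hτh, if_true]
      exact hvan' τ ⟨hτ, hτh.trans hhδ⟩ (by linarith)
    · simp only [huc_def, hτh, if_false]
      rw [eLpNorm_zero]; exact zero_le
  have h6_usmall : ∀ τ, 0 < τ → τ < h → eLpNorm (u τ) 6 volume ≤ ENNReal.ofReal (ε' * τ ^ (-(1 / 4 : ℝ))) :=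
    fun τ hτ hτh => hvan' τ ⟨hτ, hτh.trans hhδ⟩ (by linarith)
  -- pointwise bounds
  have hinf_uh : ∀ τ ∈ Ioo 0 (T - h), ∀ y, ‖uh τ y‖ ≤ b * τ ^ (-(1 / 2 : ℝ)) := by
    intro τ hτ y
    refine (hinf (τ + h) ⟨by linarith [hτ.1], by linarith [hτ.2]⟩ y).trans ?_
    exact mul_le_mul_of_nonneg_left (Real.rpow_le_rpow_of_nonpos hτ.1 (by linarith) (by norm_num)) hb
  -- the weighted modulus `ω` and its finiteness
  set ω : ℝ≥0∞ := ⨆ τ ∈ Ioo 0 (T - h), ENNReal.ofReal (τ ^ (1 / 4 : ℝ)) * eLpNorm (w τ) 6 volume with hω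
  have hω_le : ω ≤ ENNReal.ofReal (2 * a) := by
    refine iSup₂_le fun τ hτ => ?_
    have hsub : eLpNorm (w τ) 6 volume ≤ eLpNorm (uh τ) 6 volume + eLpNorm (u τ) 6 volume := by
      have : w τ = uh τ - u τ := rfl
      rw [this]
      exact eLpNorm_sub_le (hslice hsm_uh τ) (hslice hsm τ) (by norm_num)
    have hτT : τ ∈ Ioo 0 T := ⟨hτ.1, by linarith [hτ.2]⟩
    calc ENNReal.ofReal (τ ^ (1 / 4 : ℝ)) * eLpNorm (w τ) 6 volume
        ≤ ENNReal.ofReal (τ ^ (1 / 4 : ℝ)) * (ENNReal.ofReal (a * τ ^ (-(1 / 4 : ℝ))) +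
            ENNReal.ofReal (a * τ ^ (-(1 / 4 : ℝ)))) :=
          mul_le_mul' le_rfl (hsub.trans (add_le_add (h6_uh τ hτ) (h6 τ hτT)))
      _ = ENNReal.ofReal (2 * a) := by
          have hτ0 : 0 < τ := hτ.1
          rw [← ENNReal.ofReal_add (by positivity) (by positivity),
            ← ENNReal.ofReal_mul (Real.rpow_nonneg hτ.1.le _)]
          congr 1
          have : τ ^ (1 / 4 : ℝ) * τ ^ (-(1 / 4 : ℝ)) = 1 := by
            rw [← Real.rpow_add hτ.1]; norm_num
          linear_combination (2 * a) * this
  have hω_top : ω ≠ ∞ := (hω_le.trans_lt ENNReal.ofReal_lt_top).ne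
  set Ω : ℝ := ω.toReal with hΩ
  have hΩ0 : 0 ≤ Ω := ENNReal.toReal_nonneg
  have h6_w : ∀ τ ∈ Ioo 0 (T - h), eLpNorm (w τ) 6 volume ≤ ENNReal.ofReal (Ω * τ ^ (-(1 / 4 : ℝ))) := by
    intro τ hτ
    have hle : ENNReal.ofReal (τ ^ (1 / 4 : ℝ)) * eLpNorm (w τ) 6 volume ≤ ω :=
      le_iSup₂ (f := fun τ (_ : τ ∈ Ioo 0 (T - h)) =>
        ENNReal.ofReal (τ ^ (1 / 4 : ℝ)) * eLpNorm (w τ) 6 volume) τ hτ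
    have hpos : ENNReal.ofReal (τ ^ (1 / 4 : ℝ)) ≠ 0 := by
      rw [ENNReal.ofReal_ne_zero_iff]; exact Real.rpow_pos_of_pos hτ.1 _
    calc eLpNorm (w τ) 6 volume
        = (ENNReal.ofReal (τ ^ (1 / 4 : ℝ)))⁻¹ * (ENNReal.ofReal (τ ^ (1 / 4 : ℝ)) * eLpNorm (w τ) 6 volume) := by
          rw [← mul_assoc, ENNReal.inv_mul_cancel hpos ENNReal.ofReal_ne_top, one_mul]
      _ ≤ (ENNReal.ofReal (τ ^ (1 / 4 : ℝ)))⁻¹ * ω := mul_le_mul' le_rfl hle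
      _ = ENNReal.ofReal (Ω * τ ^ (-(1 / 4 : ℝ))) := by
          rw [← ENNReal.ofReal_toReal hω_top, ← hΩ,
            ← ENNReal.ofReal_inv_of_pos (Real.rpow_pos_of_pos hτ.1 _),
            ← ENNReal.ofReal_mul (inv_nonneg.2 (Real.rpow_nonneg hτ.1.le _))]
          congr 1
          rw [Real.rpow_neg hτ.1.le, mul_comm]
  -- ### product bounds for Kato's estimates
  have hp_uc : ∀ {S : ℝ}, ∀ τ ∈ Ioo 0 S, eLpNorm (fun y => ‖uc τ y‖ * ‖u τ y‖) 3 volume ≤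
      ENNReal.ofReal (ε' * ε' * τ ^ (-(1 / 2 : ℝ))) := by
    intro S τ hτ
    by_cases hτh : τ < h
    · exact eLpNorm_norm_mul_norm_three_le (hslice hsm_uc τ) (hslice hsm τ) hε'0.le hτ.1
        (h6_uc τ hτ.1) (h6_usmall τ hτ.1 hτh)
    · have h0 : (fun y => ‖uc τ y‖ * ‖u τ y‖) = fun _ => 0 := by
        funext y; simp [huc_def, hτh]
      rw [h0]; simp
  have hp_w_uh : ∀ τ ∈ Ioo 0 (T - h), eLpNorm (fun y => ‖w τ y‖ * ‖uh τ y‖) 3 volume ≤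
      ENNReal.ofReal (Ω * a * τ ^ (-(1 / 2 : ℝ))) := fun τ hτ =>
    eLpNorm_norm_mul_norm_three_le (hslice hsm_w τ) (hslice hsm_uh τ) hΩ0 hτ.1 (h6_w τ hτ) (h6_uh τ hτ)
  have hp_u_w : ∀ τ ∈ Ioo 0 (T - h), eLpNorm (fun y => ‖u τ y‖ * ‖w τ y‖) 3 volume ≤
      ENNReal.ofReal (a * Ω * τ ^ (-(1 / 2 : ℝ))) := fun τ hτ =>
    eLpNorm_norm_mul_norm_three_le (hslice hsm τ) (hslice hsm_w τ) ha hτ.1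
      (h6 τ ⟨hτ.1, by linarith [hτ.2]⟩) (h6_w τ hτ)
  -- `L⁶` products (for the absolute convergence at the points used)
  have hq_uu : ∀ τ ∈ Ioo 0 T, eLpNorm (fun y => ‖u τ y‖ * ‖u τ y‖) 6 volume ≤
      ENNReal.ofReal (a * b * τ ^ (-(3 / 4 : ℝ))) := fun τ hτ =>
    eLpNorm_norm_mul_norm_six_le_of_right (hslice hsm τ) (hslice hsm τ) ha hτ.1 (h6 τ hτ) (hinf τ hτ)
  have hq_uhuh : ∀ τ ∈ Ioo 0 (T - h), eLpNorm (fun y => ‖uh τ y‖ * ‖uh τ y‖) 6 volume ≤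
      ENNReal.ofReal (a * b * τ ^ (-(3 / 4 : ℝ))) := fun τ hτ =>
    eLpNorm_norm_mul_norm_six_le_of_right (hslice hsm_uh τ) (hslice hsm_uh τ) ha hτ.1 (h6_uh τ hτ)
      (hinf_uh τ hτ)
  have hq_uuh : ∀ τ ∈ Ioo 0 (T - h), eLpNorm (fun y => ‖u τ y‖ * ‖uh τ y‖) 6 volume ≤
      ENNReal.ofReal (a * b * τ ^ (-(3 / 4 : ℝ))) := fun τ hτ =>
    eLpNorm_norm_mul_norm_six_le_of_right (hslice hsm τ) (hslice hsm_uh τ) ha hτ.1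
      (h6 τ ⟨hτ.1, by linarith [hτ.2]⟩) (hinf_uh τ hτ)
  -- ### the decomposition at every time `σ ∈ (0, T - h)`
  have hdec : ∀ σ, 0 < σ → σ + h < T → u (σ + h) - u σ =
      (UnboundedOperators.heatExtension (UnboundedOperators.heatExtension u₀ h - u₀) σ) -
        kochTataruBilinear uc u (σ + h) - (kochTataruBilinear w uh σ + kochTataruBilinear u w σ) := by
    intro σ hσ hσT
    have hσT' : σ ∈ Ioo 0 (T - h) := ⟨hσ, by linarith⟩
    -- absolute convergence at `(σ + h, x)` and `(σ, x)`
    have hI1 : ∀ x, Integrable (fun p : ℝ × E =>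
        oseenKernel (σ + h - p.1) (x - p.2) (u p.1 p.2) (u p.1 p.2))
        ((volume : Measure (ℝ × E)).restrict (Ioo 0 (σ + h) ×ˢ univ)) := fun x =>
      (hK' hsm hsm (T := σ + h) (by positivity) (fun τ hτ => hq_uu τ ⟨hτ.1, hτ.2.trans hσT⟩)
        (σ + h) ⟨by linarith, le_rfl⟩ x).1
    have hI2 : ∀ x, Integrable (fun p : ℝ × E =>
        oseenKernel (σ - p.1) (x - p.2) (uh p.1 p.2) (uh p.1 p.2))
        ((volume : Measure (ℝ × E)).restrict (Ioo 0 σ ×ˢ univ)) := fun x =>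
      (hK' hsm_uh hsm_uh (T := σ) (by positivity) (fun τ hτ => hq_uhuh τ ⟨hτ.1, hτ.2.trans hσT'.2⟩)
        σ ⟨hσ, le_rfl⟩ x).1
    have hI3 : ∀ x, Integrable (fun p : ℝ × E =>
        oseenKernel (σ - p.1) (x - p.2) (u p.1 p.2) (uh p.1 p.2))
        ((volume : Measure (ℝ × E)).restrict (Ioo 0 σ ×ˢ univ)) := fun x =>
      (hK' hsm hsm_uh (T := σ) (by positivity) (fun τ hτ => hq_uuh τ ⟨hτ.1, hτ.2.trans hσT'.2⟩)
        σ ⟨hσ, le_rfl⟩ x).1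
    have hI4 : ∀ x, Integrable (fun p : ℝ × E =>
        oseenKernel (σ - p.1) (x - p.2) (u p.1 p.2) (u p.1 p.2))
        ((volume : Measure (ℝ × E)).restrict (Ioo 0 σ ×ˢ univ)) := fun x =>
      (hK' hsm hsm (T := σ) (by positivity) (fun τ hτ => hq_uu τ ⟨hτ.1, by linarith [hτ.2]⟩)
        σ ⟨hσ, le_rfl⟩ x).1
    -- the heat part: `U(σ+h) - U σ = e^{σΔ}(e^{hΔ}u₀ - u₀)`
    have hU : ∀ x, UnboundedOperators.heatExtension u₀ (σ + h) x - UnboundedOperators.heatExtension u₀ σ x =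
        UnboundedOperators.heatExtension (UnboundedOperators.heatExtension u₀ h - u₀) σ x := by
      intro x
      rw [heatExtension_sub_eq_of_memLp (UnboundedOperators.memLp_heatExtension_holds hu₀ h31 hh0) hu₀ h31 hσ,
        UnboundedOperators.heatExtension_add_holds hu₀ h31 hh0 hσ, add_comm h σ]
      rfl
    funext x
    have h1 := hfix (σ + h) ⟨by linarith, hσT⟩ x
    have h2 := hfix σ ⟨hσ, by linarith⟩ x
    have hsplit := kochTataruBilinear_add_time (u := u) (v := u) hσ hh0 (hI1 x)
    have hss := kochTataruBilinear_self_sub_self (u := uh) (v := u) (t := σ) (x := x) (hI2 x) (hI3 x) (hI4 x)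
    simp only [Pi.sub_apply, Pi.add_apply]
    rw [h1, h2, hsplit, ← hU x]
    have hw : uh - u = w := rfl
    rw [← hw]
    have hss' : kochTataruBilinear uh uh σ x = kochTataruBilinear (uh - u) uh σ x +
        kochTataruBilinear u (uh - u) σ x + kochTataruBilinear u u σ x := by
      rw [← hss]; abel
    rw [hss']
    abel
  -- ### Kato's estimates for the three Duhamel terms, at every `σ ∈ (0, T - h)`
  have hB1 : ∀ σ, 0 < σ → σ + h < T →
      eLpNorm (kochTataruBilinear uc u (σ + h)) 3 volume ≤ ENNReal.ofReal (K * (ε' * ε')) ∧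
        eLpNorm (kochTataruBilinear uc u (σ + h)) 6 volume ≤
          ENNReal.ofReal (K * (ε' * ε') * (σ + h) ^ (-(1 / 4 : ℝ))) := fun σ hσ hσT =>
    hK hsm_uc hsm (T := σ + h) (by positivity) (hp_uc (S := σ + h)) (σ + h) ⟨by linarith, le_rfl⟩
  have hB2 : ∀ σ, 0 < σ → σ + h < T →
      eLpNorm (kochTataruBilinear w uh σ) 3 volume ≤ ENNReal.ofReal (K * (Ω * a)) ∧
        eLpNorm (kochTataruBilinear w uh σ) 6 volume ≤ ENNReal.ofReal (K * (Ω * a) * σ ^ (-(1 / 4 : ℝ))) :=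
    fun σ hσ hσT => hK hsm_w hsm_uh (T := T - h) (by positivity) hp_w_uh σ ⟨hσ, by linarith⟩
  have hB3 : ∀ σ, 0 < σ → σ + h < T →
      eLpNorm (kochTataruBilinear u w σ) 3 volume ≤ ENNReal.ofReal (K * (a * Ω)) ∧
        eLpNorm (kochTataruBilinear u w σ) 6 volume ≤ ENNReal.ofReal (K * (a * Ω) * σ ^ (-(1 / 4 : ℝ))) :=
    fun σ hσ hσT => hK hsm hsm_w (T := T - h) (by positivity) hp_u_w σ ⟨hσ, by linarith⟩
  -- measurability of the pieces
  have hmU : ∀ σ, 0 < σ → AEStronglyMeasurable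
      (UnboundedOperators.heatExtension (UnboundedOperators.heatExtension u₀ h - u₀) σ) volume := fun σ hσ =>
    (UnboundedOperators.memLp_heatExtension_holds
      ((UnboundedOperators.memLp_heatExtension_holds hu₀ h31 hh0).sub hu₀) h31 hσ).1
  have hmB : ∀ {f g : ℝ → E → E}, StronglyMeasurable (uncurry f) → StronglyMeasurable (uncurry g) →
      ∀ t, AEStronglyMeasurable (kochTataruBilinear f g t) volume := fun hf hg t =>
    (stronglyMeasurable_kochTataruBilinear_slice (hIoi hf) (hIoi hg) t).aestronglyMeasurable
  have hηU : eLpNorm (UnboundedOperators.heatExtension u₀ h - u₀) 3 volume ≤ ENNReal.ofReal η :=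
    hheat h ⟨hh0, hhh₁⟩
  -- ### the weighted `L⁶` modulus is small: `Ω ≤ 2 (C₆ η + K ε'²)`
  have hΩ_le : Ω ≤ 2 * ((C₆ : ℝ) * η + K * (ε' * ε')) := by
    have hkey : ω ≤ ENNReal.ofReal ((C₆ : ℝ) * η + K * (ε' * ε') + 2 * K * a * Ω) := by
      refine iSup₂_le fun τ hτ => ?_
      have hτ0 : 0 < τ := hτ.1
      have hτT : τ + h < T := by linarith [hτ.2]
      have hwτ : w τ = u (τ + h) - u τ := rfl
      rw [hwτ, hdec τ hτ0 hτT]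
      -- triangle inequality in `L⁶`
      have hm1 := hmU τ hτ0
      have hm2 := hmB hsm_uc hsm (τ + h)
      have hm3 := hmB hsm_w hsm_uh τ
      have hm4 := hmB hsm hsm_w τ
      have htri : eLpNorm (UnboundedOperators.heatExtension (UnboundedOperators.heatExtension u₀ h - u₀) τ -
          kochTataruBilinear uc u (τ + h) - (kochTataruBilinear w uh τ + kochTataruBilinear u w τ)) 6 volume ≤
          eLpNorm (UnboundedOperators.heatExtension (UnboundedOperators.heatExtension u₀ h - u₀) τ) 6 volume +
            eLpNorm (kochTataruBilinear uc u (τ + h)) 6 volume +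
            (eLpNorm (kochTataruBilinear w uh τ) 6 volume + eLpNorm (kochTataruBilinear u w τ) 6 volume) := by
        refine (eLpNorm_sub_le (hm1.sub hm2) (hm3.add hm4) (by norm_num)).trans ?_
        exact add_le_add (eLpNorm_sub_le hm1 hm2 (by norm_num)) (eLpNorm_add_le hm3 hm4 (by norm_num))
      -- the four weighted terms
      have t1 : ENNReal.ofReal (τ ^ (1 / 4 : ℝ)) *
          eLpNorm (UnboundedOperators.heatExtension (UnboundedOperators.heatExtension u₀ h - u₀) τ) 6 volume ≤
          ENNReal.ofReal ((C₆ : ℝ) * η) := by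
        have h1 := hC₆' ((UnboundedOperators.memLp_heatExtension_holds hu₀ h31 hh0).sub hu₀) hτ0
        calc ENNReal.ofReal (τ ^ (1 / 4 : ℝ)) *
              eLpNorm (UnboundedOperators.heatExtension (UnboundedOperators.heatExtension u₀ h - u₀) τ) 6 volume
            ≤ ENNReal.ofReal (τ ^ (1 / 4 : ℝ)) * ((C₆ : ℝ≥0∞) * ENNReal.ofReal (τ ^ (-(1 / 4 : ℝ))) *
                ENNReal.ofReal η) := mul_le_mul' le_rfl (h1.trans (mul_le_mul' le_rfl hηU))
          _ = ENNReal.ofReal ((C₆ : ℝ) * η) := by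
              rw [← ENNReal.ofReal_coe_nnreal, ← ENNReal.ofReal_mul (by positivity),
                ← ENNReal.ofReal_mul (by positivity), ← ENNReal.ofReal_mul (by positivity)]
              congr 1
              have : τ ^ (1 / 4 : ℝ) * τ ^ (-(1 / 4 : ℝ)) = 1 := by rw [← Real.rpow_add hτ0]; norm_num
              linear_combination ((C₆ : ℝ) * η) * this
      have t2 : ENNReal.ofReal (τ ^ (1 / 4 : ℝ)) * eLpNorm (kochTataruBilinear uc u (τ + h)) 6 volume ≤
          ENNReal.ofReal (K * (ε' * ε')) := by
        refine (mul_le_mul' le_rfl (hB1 τ hτ0 hτT).2).trans ?_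
        rw [← ENNReal.ofReal_mul (by positivity)]
        refine ENNReal.ofReal_le_ofReal ?_
        have hr : τ ^ (1 / 4 : ℝ) * (τ + h) ^ (-(1 / 4 : ℝ)) ≤ 1 := by
          rw [Real.rpow_neg (by positivity), ← div_eq_mul_inv, div_le_one (Real.rpow_pos_of_pos (by positivity) _)]
          exact Real.rpow_le_rpow hτ0.le (by linarith) (by norm_num)
        have hKε : 0 ≤ K * (ε' * ε') := by positivity
        calc τ ^ (1 / 4 : ℝ) * (K * (ε' * ε') * (τ + h) ^ (-(1 / 4 : ℝ)))
            = K * (ε' * ε') * (τ ^ (1 / 4 : ℝ) * (τ + h) ^ (-(1 / 4 : ℝ))) := by ring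
          _ ≤ K * (ε' * ε') * 1 := mul_le_mul_of_nonneg_left hr hKε
          _ = K * (ε' * ε') := mul_one _
      have hwt : ∀ {c : ℝ}, 0 ≤ c → ∀ {f : E → E}, eLpNorm f 6 volume ≤ ENNReal.ofReal (K * c * τ ^ (-(1 / 4 : ℝ))) →
          ENNReal.ofReal (τ ^ (1 / 4 : ℝ)) * eLpNorm f 6 volume ≤ ENNReal.ofReal (K * c) := by
        intro c hc f hf
        refine (mul_le_mul' le_rfl hf).trans (le_of_eq ?_)
        rw [← ENNReal.ofReal_mul (by positivity)]
        congr 1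
        have : τ ^ (1 / 4 : ℝ) * τ ^ (-(1 / 4 : ℝ)) = 1 := by rw [← Real.rpow_add hτ0]; norm_num
        linear_combination (K * c) * this
      have t3 := hwt (by positivity : 0 ≤ Ω * a) (hB2 τ hτ0 hτT).2
      have t4 := hwt (by positivity : 0 ≤ a * Ω) (hB3 τ hτ0 hτT).2
      calc ENNReal.ofReal (τ ^ (1 / 4 : ℝ)) * eLpNorm (UnboundedOperators.heatExtension
            (UnboundedOperators.heatExtension u₀ h - u₀) τ - kochTataruBilinear uc u (τ + h) -
            (kochTataruBilinear w uh τ + kochTataruBilinear u w τ)) 6 volume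
          ≤ ENNReal.ofReal (τ ^ (1 / 4 : ℝ)) *
              (eLpNorm (UnboundedOperators.heatExtension (UnboundedOperators.heatExtension u₀ h - u₀) τ) 6 volume +
                eLpNorm (kochTataruBilinear uc u (τ + h)) 6 volume +
                (eLpNorm (kochTataruBilinear w uh τ) 6 volume + eLpNorm (kochTataruBilinear u w τ) 6 volume)) :=
            mul_le_mul' le_rfl htri
        _ = ENNReal.ofReal (τ ^ (1 / 4 : ℝ)) *
              eLpNorm (UnboundedOperators.heatExtension (UnboundedOperators.heatExtension u₀ h - u₀) τ) 6 volume +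
            ENNReal.ofReal (τ ^ (1 / 4 : ℝ)) * eLpNorm (kochTataruBilinear uc u (τ + h)) 6 volume +
            (ENNReal.ofReal (τ ^ (1 / 4 : ℝ)) * eLpNorm (kochTataruBilinear w uh τ) 6 volume +
              ENNReal.ofReal (τ ^ (1 / 4 : ℝ)) * eLpNorm (kochTataruBilinear u w τ) 6 volume) := by ring
        _ ≤ ENNReal.ofReal ((C₆ : ℝ) * η) + ENNReal.ofReal (K * (ε' * ε')) +
            (ENNReal.ofReal (K * (Ω * a)) + ENNReal.ofReal (K * (a * Ω))) :=
            add_le_add (add_le_add t1 t2) (add_le_add t3 t4)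
        _ = ENNReal.ofReal ((C₆ : ℝ) * η + K * (ε' * ε') + 2 * K * a * Ω) := by
            rw [← ENNReal.ofReal_add (by positivity) (by positivity),
              ← ENNReal.ofReal_add (by positivity) (by positivity),
              ← ENNReal.ofReal_add (by positivity) (by positivity)]
            congr 1; ring
    have hreal : Ω ≤ (C₆ : ℝ) * η + K * (ε' * ε') + 2 * K * a * Ω := by
      have h := ENNReal.toReal_mono ENNReal.ofReal_ne_top hkey
      rwa [ENNReal.toReal_ofReal (by positivity)] at h
    nlinarith [hreal, hKa, hΩ0]
  -- ### the `L³` estimate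
  have hm1 := hmU s hs
  have hm2 := hmB hsm_uc hsm (s + h)
  have hm3 := hmB hsm_w hsm_uh s
  have hm4 := hmB hsm hsm_w s
  rw [hdec s hs hsT]
  have htri : eLpNorm (UnboundedOperators.heatExtension (UnboundedOperators.heatExtension u₀ h - u₀) s -
      kochTataruBilinear uc u (s + h) - (kochTataruBilinear w uh s + kochTataruBilinear u w s)) 3 volume ≤
      eLpNorm (UnboundedOperators.heatExtension (UnboundedOperators.heatExtension u₀ h - u₀) s) 3 volume +
        eLpNorm (kochTataruBilinear uc u (s + h)) 3 volume +
        (eLpNorm (kochTataruBilinear w uh s) 3 volume + eLpNorm (kochTataruBilinear u w s) 3 volume) := by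
    refine (eLpNorm_sub_le (hm1.sub hm2) (hm3.add hm4) h31).trans ?_
    exact add_le_add (eLpNorm_sub_le hm1 hm2 h31) (eLpNorm_add_le hm3 hm4 h31)
  have s1 : eLpNorm (UnboundedOperators.heatExtension (UnboundedOperators.heatExtension u₀ h - u₀) s) 3 volume ≤
      ENNReal.ofReal η :=
    (UnboundedOperators.eLpNorm_heatExtension_le_holds
      ((UnboundedOperators.memLp_heatExtension_holds hu₀ h31 hh0).sub hu₀) h31 hs).trans hηU
  refine htri.trans ?_
  refine (add_le_add (add_le_add s1 (hB1 s hs hsT).1) (add_le_add (hB2 s hs hsT).1 (hB3 s hs hsT).1)).trans ?_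
  rw [← ENNReal.ofReal_add (by positivity) (by positivity),
    ← ENNReal.ofReal_add (by positivity) (by positivity),
    ← ENNReal.ofReal_add (by positivity) (by positivity)]
  refine ENNReal.ofReal_le_ofReal ?_
  -- `η + Kε'² + 2KaΩ ≤ ε`
  have hη4 : η * (4 * ((C₆ : ℝ) + 1)) = ε := by rw [hη]; field_simp
  have hC₆0 : 0 ≤ (C₆ : ℝ) := C₆.coe_nonneg
  nlinarith [hΩ_le, hKa, hε'sq, hC₆0, hη0, mul_nonneg hK0.le ha, mul_nonneg hC₆0 hη0.le,
    mul_nonneg (mul_nonneg hK0.le ha) hΩ0]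

/-! ### Continuity in `L³` on `[0, T)` -/

/-- A positive `ε : ℝ≥0∞` dominates `ofReal δ` for some real `δ > 0`. [folklore] -/
theorem exists_ofReal_le_of_pos {ε : ℝ≥0∞} (hε : 0 < ε) : ∃ δ : ℝ, 0 < δ ∧ ENNReal.ofReal δ ≤ ε := by
  rcases eq_or_ne ε ∞ with h | h
  · exact ⟨1, one_pos, h ▸ le_top⟩
  · refine ⟨ε.toReal, ENNReal.toReal_pos hε.ne' h, ?_⟩
    rw [ENNReal.ofReal_toReal h]

/-- **Kato fixed points lie in `C([0,T); L³)`** (Kato 1984, Thm. 1: `u ∈ BC([0,T); L³)`;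
Lemarié-Rieusset 2016, Thm. 7.5 and its proof, PDF p. 157). In dimension three there is
`ε₀ = ε₀(E) > 0` such that every jointly strongly measurable pointwise fixed point
`u(t) = e^{tΔ}u₀ - B(u,u)(t)` on `(0, T)` (`B = kochTataruBilinear`, `u₀ ∈ L³`, `u(0) = u₀`) in
Kato's weighted class (`‖u(t)‖₆ ≤ a t^{-1/4}`, `a ≤ ε₀`; `|u(t,x)| ≤ b t^{-1/2}`; and
`∀ ε ∃ δ ∀ t < δ, ‖u(t)‖₆ ≤ ε t^{-1/4}`) satisfies `Fluid.ContinuousInLpOn (Ico 0 T) 3 u`: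
slices in `L³` (`e^{tΔ}u₀ ∈ L³`, `B(u,u)(t) ∈ L³` by Kato's estimate), continuity at `t = 0` by
`‖u(t) - u₀‖₃ ≤ ‖e^{tΔ}u₀ - u₀‖₃ + K ε(t)²`, and at `t₀ ∈ (0,T)` by the uniform modulus
`exists_modulus_of_fixedPoint`. [cite: LemarieRieusset2016, Thm. 7.5 (proof, PDF p. 157)] -/
theorem exists_continuousInLpOn_of_fixedPoint (hE : Module.finrank ℝ E = 3) :
    ∃ ε₀ : ℝ, 0 < ε₀ ∧ ∀ {u₀ : E → E} {u : ℝ → E → E} {T a b : ℝ},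
      MemLp u₀ 3 volume → StronglyMeasurable (uncurry u) → 0 ≤ a → a ≤ ε₀ → 0 ≤ b →
      u 0 = u₀ →
      (∀ t ∈ Ioo 0 T, ∀ x, u t x =
        UnboundedOperators.heatExtension u₀ t x - kochTataruBilinear u u t x) →
      (∀ t ∈ Ioo 0 T, eLpNorm (u t) 6 volume ≤ ENNReal.ofReal (a * t ^ (-(1 / 4 : ℝ)))) →
      (∀ t ∈ Ioo 0 T, ∀ x, ‖u t x‖ ≤ b * t ^ (-(1 / 2 : ℝ))) →
      (∀ ε > 0, ∃ δ > 0, ∀ t ∈ Ioo 0 δ, t < T →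
        eLpNorm (u t) 6 volume ≤ ENNReal.ofReal (ε * t ^ (-(1 / 4 : ℝ)))) →
      ContinuousInLpOn (Ico 0 T) 3 u := by
  obtain ⟨ε₀, hε₀, hmod⟩ := exists_modulus_of_fixedPoint hE
  obtain ⟨K, hK0, hK⟩ := exists_eLpNorm_kochTataruBilinear_le hE
  refine ⟨ε₀, hε₀, fun {u₀ u T a b} hu₀ hsm ha haε hb hu0 hfix h6 hinf hvan => ?_⟩
  have h31 : (1 : ℝ≥0∞) ≤ 3 := by norm_num
  have hslice : ∀ τ, AEStronglyMeasurable (u τ) volume := fun τ =>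
    (hsm.comp_measurable (measurable_const.prodMk measurable_id)).aestronglyMeasurable
  have hIoi : AEStronglyMeasurable (uncurry u) ((volume : Measure (ℝ × E)).restrict (Ioi 0 ×ˢ univ)) :=
    hsm.aestronglyMeasurable
  -- `B(u,u)(t) ∈ L³` with `‖B(u,u)(t)‖₃ ≤ K m` whenever `‖u(τ)‖₆ ≤ c τ^{-1/4}` on `(0, t)`
  have hB : ∀ {c : ℝ}, 0 ≤ c → ∀ {t : ℝ}, 0 < t →
      (∀ τ ∈ Ioo 0 t, eLpNorm (u τ) 6 volume ≤ ENNReal.ofReal (c * τ ^ (-(1 / 4 : ℝ)))) →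
      MemLp (kochTataruBilinear u u t) 3 volume ∧
        eLpNorm (kochTataruBilinear u u t) 3 volume ≤ ENNReal.ofReal (K * (c * c)) := by
    intro c hc t ht hc6
    have hp : ∀ τ ∈ Ioo 0 t, eLpNorm (fun y => ‖u τ y‖ * ‖u τ y‖) 3 volume ≤
        ENNReal.ofReal (c * c * τ ^ (-(1 / 2 : ℝ))) := fun τ hτ =>
      eLpNorm_norm_mul_norm_three_le (hslice τ) (hslice τ) hc hτ.1 (hc6 τ hτ) (hc6 τ hτ)
    have hb := (hK hsm hsm (T := t) (by positivity) hp t ⟨ht, le_rfl⟩).1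
    exact ⟨⟨(stronglyMeasurable_kochTataruBilinear_slice hIoi hIoi t).aestronglyMeasurable,
      hb.trans_lt ENNReal.ofReal_lt_top⟩, hb⟩
  have hmem : ∀ t ∈ Ico 0 T, MemLp (u t) 3 volume := by
    intro t ht
    rcases ht.1.eq_or_lt with h | hpos
    · rw [← h, hu0]; exact hu₀
    · have heq : u t = fun x => UnboundedOperators.heatExtension u₀ t x - kochTataruBilinear u u t x :=
        funext (hfix t ⟨hpos, ht.2⟩)
      rw [heq]
      exact (UnboundedOperators.memLp_heatExtension_holds hu₀ h31 hpos).sub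
        (hB ha hpos fun τ hτ => h6 τ ⟨hτ.1, hτ.2.trans ht.2⟩).1
  refine ⟨hmem, fun t₀ ht₀ => ?_⟩
  rw [ENNReal.tendsto_nhds_zero]
  intro ε hε
  obtain ⟨δ', hδ', hδ'ε⟩ := exists_ofReal_le_of_pos hε
  rcases ht₀.1.eq_or_lt with h0 | hpos
  · -- continuity at `t₀ = 0`
    subst h0
    -- heat semigroup part
    have ht := UnboundedOperators.tendsto_heatExtension_nhdsWithin_zero_holds hu₀ h31 (by norm_num)
    have hev := (ENNReal.tendsto_nhds_zero.1 ht) (ENNReal.ofReal (δ' / 2)) (by simpa using half_pos hδ')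
    obtain ⟨h₁, hh₁, hsub⟩ := mem_nhdsGT_iff_exists_Ioo_subset.1 hev
    -- Duhamel part
    set ε' : ℝ := min 1 (δ' / (2 * (K + 1))) with hε'
    have hε'0 : 0 < ε' := lt_min one_pos (by positivity)
    have hKε : K * (ε' * ε') ≤ δ' / 2 := by
      have h1 : ε' * ε' ≤ ε' := by nlinarith [min_le_left (1 : ℝ) (δ' / (2 * (K + 1)))]
      have h2 : ε' ≤ δ' / (2 * (K + 1)) := min_le_right _ _
      calc K * (ε' * ε') ≤ K * (δ' / (2 * (K + 1))) := by nlinarith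
        _ ≤ δ' / 2 := by
            rw [mul_comm, div_mul_eq_mul_div, div_le_div_iff₀ (by positivity) (by positivity)]; nlinarith
    obtain ⟨δ, hδ, hvan'⟩ := hvan ε' hε'0
    have hnhds : Ico 0 T ∩ Iio (min h₁ δ) ∈ 𝓝[Ico 0 T] (0 : ℝ) :=
      inter_mem_nhdsWithin _ (Iio_mem_nhds (lt_min hh₁ hδ))
    filter_upwards [hnhds] with t ht
    rcases ht with ⟨htT, htmin⟩
    rw [mem_Iio] at htmin
    rcases htT.1.eq_or_lt with h | htpos
    · rw [← h, sub_self, eLpNorm_zero]; exact zero_le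
    · have hth₁ : t < h₁ := lt_of_lt_of_le htmin (min_le_left _ _)
      have htδ : t < δ := lt_of_lt_of_le htmin (min_le_right _ _)
      have hBt := hB hε'0.le htpos fun τ hτ => hvan' τ ⟨hτ.1, hτ.2.trans htδ⟩ (hτ.2.trans htT.2)
      have heq : u t - u 0 = (fun x => UnboundedOperators.heatExtension u₀ t x - u₀ x) -
          kochTataruBilinear u u t := by
        funext x
        simp only [Pi.sub_apply, hfix t ⟨htpos, htT.2⟩ x, hu0]
        abel
      rw [heq]
      have hmU : AEStronglyMeasurable (fun x => UnboundedOperators.heatExtension u₀ t x - u₀ x) volume :=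
        (UnboundedOperators.memLp_heatExtension_holds hu₀ h31 htpos).1.sub hu₀.1
      refine (eLpNorm_sub_le hmU hBt.1.1 h31).trans ?_
      refine (add_le_add (hsub ⟨htpos, hth₁⟩) (hBt.2.trans (ENNReal.ofReal_le_ofReal hKε))).trans ?_
      rw [← ENNReal.ofReal_add (by positivity) (by positivity), add_halves]
      exact hδ'ε
  · -- continuity at `t₀ ∈ (0, T)` from the uniform modulus
    obtain ⟨h₀, hh₀, hmod'⟩ := hmod hu₀ hsm ha haε hb hfix h6 hinf hvan δ' hδ'
    have hnhds : Ico 0 T ∩ Metric.ball t₀ (min h₀ (t₀ / 2)) ∈ 𝓝[Ico 0 T] t₀ :=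
      inter_mem_nhdsWithin _ (Metric.ball_mem_nhds t₀ (lt_min hh₀ (half_pos hpos)))
    filter_upwards [hnhds] with t ht
    rcases ht with ⟨htT, hdist⟩
    rw [Metric.mem_ball, Real.dist_eq] at hdist
    have hd₁ : |t - t₀| < h₀ := lt_of_lt_of_le hdist (min_le_left _ _)
    have hd₂ : |t - t₀| < t₀ / 2 := lt_of_lt_of_le hdist (min_le_right _ _)
    rcases lt_trichotomy t t₀ with hlt | heq | hgt
    · have hpos' : 0 < t := by
        rw [abs_sub_comm, abs_of_pos (sub_pos.2 hlt)] at hd₂; linarith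
      have hh : t₀ - t ∈ Ioo 0 h₀ := ⟨sub_pos.2 hlt, by rw [abs_sub_comm, abs_of_pos (sub_pos.2 hlt)] at hd₁; exact hd₁⟩
      have h := hmod' (t₀ - t) hh t hpos' (by linarith [ht₀.2])
      rw [show t + (t₀ - t) = t₀ by ring] at h
      rw [eLpNorm_sub_comm]
      exact h.trans hδ'ε
    · rw [heq, sub_self, eLpNorm_zero]; exact zero_le
    · have hh : t - t₀ ∈ Ioo 0 h₀ := ⟨sub_pos.2 hgt, by rw [abs_of_pos (sub_pos.2 hgt)] at hd₁; exact hd₁⟩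
      have h := hmod' (t - t₀) hh t₀ hpos (by linarith [htT.2])
      rw [show t₀ + (t - t₀) = t by ring] at h
      exact h.trans hδ'ε

end KatoL3

end Literature.Analysis.FluidPDE
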